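import Literature.AlgebraicGeometry.Motives.AbelianVariety
import Literature.AlgebraicGeometry.HodgeTheory.HodgeConjecture
import HarnessLib.Audit
import HarnessLib

/-!
# WeilTypeLadderSixfolds — the node "HC for ALL complex abelian sixfolds" (R6) and its envelope "dimension ≤ 7" (R7)
# above rung R1 of the Weil-type ladder (CONJECTURES; obligations of HodgeConjecture/HodgeConjecture)

b2b cell `hweil` (packet `run/shared/lean/b2b/hodge-weil/`, LADDER.md `## CARVER` v2.1, R6 concordance).
Conjecture LEAF in the conventions of `Theorems/WeilTypeLadder.lean` (only `@[conjecture]` definitions;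
imports only `Literature.*` / `HarnessLib`; nothing asserted, no `_holds` in sight).

* `AbelianSixfolds` (R6) — the Hodge conjecture `HodgeConjectureFor A.dim A.X` for EVERY complex abelian
  variety `A` of dimension `6` (not only Weil-type ones, not only Weil classes).
* `AbelianDimLeSeven` (R7) — the same for every complex abelian variety of dimension `≤ 7`; this is
  LITERALLY the conclusion of the assembly item of route `SevenfoldWeilCensus`
  (`Theses.SevenfoldWeilCensus.Assembly`, stmt-HodgeConjecture-18724, proved:
  `Theorems.sevenfoldWeilCensus_assembly_proof`).

WHERE THEY SIT (kernel-checked in the sibling `Theorems/WeilTypeLadderSixfoldsOnPath.lean`):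
`HodgeConjecture → AbelianDimLeSeven → AbelianSixfolds → WeilSixfolds` (R1 = stmt-HodgeConjecture-2524:
a Weil class of `(A, φ² = -d)` is a rational `(3,3)`-class on a sixfold), and in the other direction the
CLASSICAL-STYLE REDUCTION two dimensions past Moonen–Zarhin (Math. Ann. 315 (1999), arXiv:math/9901113,
dim `≤ 5`): `CodimTwoFromLowerDim → CodimThreeWeilGeneration → WeilSixfolds → HodgeAbelianDimLeFive →
AbelianDimLeSeven` — the two CENSUS cruxes of route `SevenfoldWeilCensus` (stmt-18721 codim 2, stmt-18720
codim 3; OPEN Hodge-theoretic statements, NOT cases of the Hodge conjecture), rung R1, and the dim `≤ 5`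
floor (Markman 2025 Cor. 1.3 with Moonen–Zarhin 1999; cite-only named fact
`Markman2025_hodgeClasses_algebraic_abelian_dim_le_five`, an UNREFEREED preprint arXiv:2502.03415 —
conditional on [Markman 2025, Cor. 1.3]). So "HC for all abelian sixfolds" is NOT a rung of Markman's
Weil-type ladder: modulo the dim `≤ 5` floor it is `R1 ∧ (census X1 ∧ X2 at dimension 6)`, and the census
may fail exactly at simple sixfolds with small Hodge group (degenerate CM types of degree 12 — for a SIMPLE
CM sixfold X2 demands `B²(A) = D²(A)` since there is no lower-dimensional quotient; type IV over CM fields of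
degree 4 or 6; type III(1), where `B³ ⊇ Sym⁶ ⊗ det` is spanned by the Weil classes of the infinitely many
imaginary quadratic `k ⊂ D`, cf. Moonen–Zarhin Duke 77 (1995) 7.2 for the fourfold analogue, van Geemen
1994 §4.13). References for the known simple cases at `g = 6`: Tankeev / Ribet (prime `g` only — not 6),
Pink 1998 Thm 5.14 (`End = ℤ`, `2g = 12` not exceptional ⇒ `Hg = Sp₁₂`), Banaszak–Gajda–Krasoń 2006 (types
I/II of odd relative dimension), Murty 1984 (type III carries exceptional classes), Hazama 1985 and
Moonen–Zarhin 1999 §3 (products).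

STATUS UPDATE (2026-08-18, packet referee objection G10; docstring only, statements byte-identical). The
census crux X2 (`Theses.SevenfoldWeilCensus.CodimTwoFromLowerDim`, stmt-HodgeConjecture-18721) is REFUTED AT
EVIDENCE LEVEL (packet `b2b-hweil-carver-g2/x2-refutation-evidence.md`; kernel-checked combinatorial census
`Literature/AlgebraicGeometry/HodgeTheory/PohlmannSetsZeta24ProductSixfold`, p176557): on the CM sixfold
`B × E′ × E″` — `B` the simple CM fourfold of type `(ℚ(ζ₂₄), {σ₁, σ₅, σ₇, σ₁₃})`, `E′, E″` CM elliptic curves by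
two distinct imaginary quadratic subfields of `ℚ(ζ₂₄)` — the rational `(2,2)`-classes have dimension
`19 = 15 + 4`, `15 = dim (D² + pull-backs from quotients of dimension < 6)`. The prediction above ("the census
may fail exactly at simple sixfolds") was wrong the other way round: all `280` simple CM configurations of
dimension `6` conform (job j038435), and X2 fails on PRODUCTS of dimension patterns `(4,1,1)`, `(4,2)`, `(2,2,2)`
(`38` configurations over `12` Galois data, job j038496); X1 (stmt-18720) conforms on every CM configuration
computed. Consequences: (i) the reduction `abelianSixfolds_of_census` / `abelianDimLeSeven_of_census` of the
sibling `Theorems/WeilTypeLadderSixfoldsOnPath.lean` remains a kernel-checked IMPLICATION, now with an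
(evidence-level) false antecedent — retained as an implication, no longer a plan; (ii) the item stays formally
`open`: a Lean `¬ CodimTwoFromLowerDim` needs a CM constructor on `AbelianVariety ℂ` (packet DIVERGENCE D11);
(iii) the four exceptional classes of the witness are nevertheless ALGEBRAIC modulo the refereed theorem
[Aoki 2002, Thm. 1.2 (ii)]: the witness is an isogeny factor of `J(F₂₄)³`, `24 = 2³·3` an Aoki degree
(`Theorems/WeilTypeLadderFermatTwentyFour.lean`, p177003; packet LADDER `## CARVER — v3` C20, DIVERGENCE D12).
The honest residual of R6 beyond `R1 ∧ X1 ∧ floor` is therefore the André-type node R6ᴬ of the packet DAG: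
Hodge classes on NON-Fermat CM products of the violating patterns, which André's theorem (tree fact
`Andre1992_hodgeClasses_cmAbelianVariety_mem_span_pullback_weilClasses`, p176378) sends to pull-backs of Weil
classes over CM fields, i.e. to rungs R∞ / R3 of `Theorems/WeilTypeLadder.lean` (packet LADDER C12, C16, C20).
-/

-- every declaration of this problem lives in `Summit.HodgeConjecture.HodgeConjecture.…` (summit = sub-problem)
set_option linter.dupNamespace false

noncomputable section

namespace Summit.HodgeConjecture.HodgeConjecture.WeilTypeLadder

open Literature.AlgebraicGeometry Literature.AlgebraicGeometry.Motives
open Literature.AlgebraicGeometry.HodgeTheory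

/-- **R6 — the Hodge conjecture for every complex abelian SIXFOLD.** For every complex abelian variety `A`
with `A.dim = 6`: `HodgeConjectureFor A.dim A.X` (a Hodge model exists — a theorem for abelian varieties —
and every rational `(p,p)`-class in `H^{2p}(A(ℂ); ℂ)` is algebraic, all `p`). Strictly contains rung R1
(`Theses.SevenfoldWeilCensus.WeilSixfolds`, stmt-HodgeConjecture-2524): `weilSixfolds_of_abelianSixfolds`.
OPEN; by the sevenfold reduction it follows from R1, the census cruxes stmt-18720/18721 and the dim `≤ 5`
floor (`abelianSixfolds_of_census`) — an implication whose X2 leg (stmt-18721) is refuted at evidence level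
(2026-08-18; module docstring, STATUS UPDATE): retained as an implication, not a plan. Conjecture, not a fact. -/
@[conjecture] def AbelianSixfolds : Prop :=
  ∀ A : AbelianVariety ℂ, A.dim = 6 → IsSmoothProjective A.dim A.X → HodgeConjectureFor A.dim A.X

/-- **R7 — the Hodge conjecture for every complex abelian variety of dimension `≤ 7`** (verbatim the
conclusion of `Theses.SevenfoldWeilCensus.Assembly`, stmt-HodgeConjecture-18724). OPEN above dimension 5;
`abelianDimLeSeven_of_census` is the kernel-checked reduction to the census cruxes, R1 and the floor (its X2
leg, stmt-18721, is refuted at evidence level, 2026-08-18 — module docstring, STATUS UPDATE).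
Conjecture, not a fact. -/
@[conjecture] def AbelianDimLeSeven : Prop :=
  ∀ A : AbelianVariety ℂ, A.dim ≤ 7 → IsSmoothProjective A.dim A.X → HodgeConjectureFor A.dim A.X

end Summit.HodgeConjecture.HodgeConjecture.WeilTypeLadder

end
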